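import Summits.KontsevichZagierPeriods.KontsevichZagierPeriods.Theorems.MzvKernelInKZTwoPosetsTransfer
import Summits.KontsevichZagierPeriods.KontsevichZagierPeriods.Theorems.MzvKernelInKZTwoPosetsCubicalChart
import Summits.KontsevichZagierPeriods.KontsevichZagierPeriods.Theorems.MzvKernelInKZTwoPosetsHoffmanIndependence
import Summits.KontsevichZagierPeriods.KontsevichZagierPeriods.Theorems.MzvKernelInKZTwoPosetsShuffleProduct
import Summits.KontsevichZagierPeriods.KontsevichZagierPeriods.Theorems.MzvKernelInKZTwoPosetsEdsCertificateLow
import Summits.KontsevichZagierPeriods.KontsevichZagierPeriods.Theorems.MzvKernelInKZTwoPosetsFurushoBridge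
import Summits.KontsevichZagierPeriods.KontsevichZagierPeriods.Theorems.MzvKernelInKZTwoPosetsInteriorLanden
import Summits.KontsevichZagierPeriods.KontsevichZagierPeriods.Theorems.MzvKernelInKZTwoPosetsHoffmanDepthOne
import Summits.KontsevichZagierPeriods.KontsevichZagierPeriods.Theorems.FurushoPentagonStuffleInKZ
import Summits.KontsevichZagierPeriods.KontsevichZagierPeriods.Theorems.FurushoPentagonHoffmanRelationInKZ

/-!
# `MzvKernelInKZ` (stmt-KontsevichZagierPeriods-3914) — SKELETON of line two-posets-interior-landen (v4)

v4 (lead gen 1, 2026-08-16): the neighbouring crux `HoffmanRelationInKZ` (route FurushoPentagon,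
item stmt-KontsevichZagierPeriods-3930) is PROVED in the tree
(`FurushoPentagon.HoffmanRelationInKZ.hoffmanRelationInKZ_proof`), so the former stub
`stub_hoffmanRelationInKZ` is discharged and the composition `MzvKernelInKZ_of` concludes the crux
BY NAME from exactly TWO registered stubs — the only `sorry`s:

* `stub_edsComplete : EdsComplete` — completeness of the per-weight EDS certificates in ALL weights
  (Ihara–Kaneko–Zagier 2006, Conjecture 1, in certificate form; decidable per weight, landed for
  `N ≤ 6` as `stub_edsCertificateLow`; weights 7–10 are stubs of crux HoffmanSpanInKZ's line,
  item stmt-KontsevichZagierPeriods-15044);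
* `stub_hoffmanIndependent : HoffmanIndependent` — `ℚ`-independence of the real Hoffman values
  (verbatim route item stmt-KontsevichZagierPeriods-15045 `HoffmanIndependence`; = Zagier's
  conjecture given Brown's theorem, bridge `stub_hoffmanIndependentOfZagier` landed).

Everything else is a LANDED theorem of `Theorems/MzvKernelInKZTwoPosets*.lean`: realisation
bookkeeping `stub_realisation`, the transfer `transferCore`, cubical chart `stub_cubicalChart`,
interior Landen `stub_interiorLanden`, depth-one Hoffman `stub_hoffmanDepthOne`, shuffle =
dissection `stub_shuffleProduct`, stuffle through `stub_stuffleProductOfFurusho` + route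
FurushoPentagon's `StuffleInKZ_of`, deep Hoffman through `stub_hoffmanDeepOfFurusho`.
The two remaining stubs are the two classical conjectures the crux is known to require
(disprover, Negative/Transfer.lean `zeta_three_not_mem_span_of_crux`: a proof of the crux is
transcendence-complete; the route's `closes` accordingly DERIVES the crux from items 15044 ∧ 15045).
-/

noncomputable section

namespace Summit.KontsevichZagierPeriods.MzvKernelInKZ.TwoPosets

open Literature.NumberTheory.Transcendental
open Summit.KontsevichZagierPeriods.MzvKernelInKZ.Negative

/-! ## Registered stubs still open (the only `sorry`s) -/

/-- STUB (conjectural for all weights — IKZ completeness; instances decidable, `N ≤ 6` landed,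
`7 ≤ N ≤ 10` being landed under crux HoffmanSpanInKZ): completeness of the certificates. -/
theorem stub_edsComplete : EdsComplete := by
  sorry

/-- STUB (open transcendence input; verbatim route item `HoffmanIndependence`,
stmt-KontsevichZagierPeriods-15045; = `ZagierConjecture ∧ hoffmanSpan_eq_mzvSpace` by the landed
`stub_hoffmanIndependentOfZagier`): Hoffman independence. -/
theorem stub_hoffmanIndependent : HoffmanIndependent := by
  sorry

/-! ## Discharged former stub -/

/-- Former stub `stub_hoffmanRelationInKZ`, now the tree's theorem (item 3930 closed). -/
theorem stub_hoffmanRelationInKZ :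
    Summit.KontsevichZagierPeriods.KontsevichZagierPeriods.Theses.FurushoPentagon.HoffmanRelationInKZ :=
  Summit.KontsevichZagierPeriods.FurushoPentagon.HoffmanRelationInKZ.hoffmanRelationInKZ_proof

/-! ## Composition -/

/-- **The crux from the stubs** (all calculus inputs landed; two conjectural inputs open). -/
theorem MzvKernelInKZ_of :
    Summit.KontsevichZagierPeriods.KontsevichZagierPeriods.Theses.LinRedNormalForm.MzvKernelInKZ :=
  transferCore stub_realisation (stub_hoffmanDepthOne stub_cubicalChart stub_interiorLanden)
    stub_shuffleProduct
    (stub_stuffleProductOfFurusho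
      Summit.KontsevichZagierPeriods.FurushoPentagon.StuffleInKZ.StuffleInKZ_of)
    (stub_hoffmanDeepOfFurusho stub_hoffmanRelationInKZ) stub_edsComplete stub_hoffmanIndependent

end Summit.KontsevichZagierPeriods.MzvKernelInKZ.TwoPosets
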